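import Mathlib.FieldTheory.AlgebraicClosure
import Mathlib.FieldTheory.KrullTopology
import Mathlib.FieldTheory.Normal.Defs
import Mathlib.Topology.Algebra.ContinuousMonoidHom
import Literature.FieldTheory.FunctionField.RationalClosedPointResidues
import HarnessLib

/-!
# [IUTchI] Example 5.4 (iv), p. 149 — the RESTRICTION DATA of the `∞κ`-compatibility clause at print's
# arithmetic function-field model: base change `F_mod(t) → K_v(t)`, `ι_v : Λ_{F_mod} → Λ_{K_v}`, and the
# induced continuous homomorphism `π₁^{rat}(‡𝒟_v) → π₁^{rat}(†𝒟^⊛)` (cell abc-iut, GAP B = G-L5t9g8-1,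
# item GB-03 = row D3 of `GAP-SIZING-B.md` 2de24246389ab103; seat abc-iut-gapB-03-restrictionData)

S. Mochizuki, *Inter-universal Teichmüller theory I*, kurims manuscript (May 2020), Example 5.4 (iv) p. 149
ll. 3–31: «the operation of restriction of associated Kummer classes … determines a collection, indexed by
`v ∈ 𝕍`, of poly-morphisms of pseudo-monoids `{π₁^{rat}(†𝒟^⊛) ↷ †𝕄^⊛_{∞κ} → ‡𝕄_{∞κv} ⊆ ‡𝕄_{∞κ×v}}_{v∈𝕍}` — where
the global data … is regarded as only being defined up to automorphisms induced by inner automorphisms of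
`π₁^{rat}(†𝒟^⊛)` … equivariant with respect to the various homomorphisms `π₁^{rat}(‡𝒟_v) → π₁^{rat}(†𝒟^⊛)` …
induced [cf. … [AbsTopIII], Theorem 1.9, and [AbsTopIII], Corollaries 1.10, 2.8] by the given poly-morphism»
([IUTchI] Ex 5.4 (iv) p.149) [claim: Mochizuki2012, status: disputed] (D-0012 claim key; THIS file is elementary
field theory at the MODEL PRESENTATION of Ex 5.1 (i)/(v) pp. 123–128 and Def 5.2 (v)–(viii) pp. 135–142 —
`π₁^{rat}(†𝒟^⊛)` «the absolute Galois group of the function field of `C_{F_mod}`», `π₁^{rat}(‡𝒟_v)` its analogue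
after «base-changing to `(F_mod)_v`»; nothing disputed is involved; no side is taken on [IUTchIII] Cor. 3.12).

## What is constructed (RULINGS #316 (i) «resKummer = base change ι_v, ratHom = Galois restriction»;
## #331 §7 «typed over Mathlib objects directly»)

For a field homomorphism `φ : L →+* L'` (intended `F_mod → K_v`; equally the geometric reading `F̄ → K̄_v`
of RULINGS #318 / risk locus R1 — the file is generic), `Λ_L := AlgebraicClosure (RatFunc L)` (print's `L̄_C`,
Rmk 3.1.7 (ii) p. 67), `G_L^{rat} := Λ_L ≃ₐ[L(t)] Λ_L` with Mathlib's Krull topology, and `ψ := ratFuncMapCoeffs φ :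
L(t) →+* L'(t)` the constant-field extension REUSED from `Literature.FieldTheory.FunctionField` (Chevalley VI
§6; `ratFuncMapCoeffs_div/_C/_X`, and for the clause-(a) item downstream `num_/denom_ratFuncMapCoeffs`):
* `baseAlgebra φ` — the `L(t)`-algebra structure on `Λ_{L'}` through `ψ` (a `def`, NOT an instance);
* `iota φ : Λ_L →+* Λ_{L'}` over `ψ` (`IsAlgClosed.lift`; `iota_algebraMap`) = «restriction of associated
  Kummer classes» on carriers (`resKummer`); `mem_range_iota_iff` — PROVED: the image of ANY embedding over
  `ψ` is EXACTLY the relative algebraic closure of `L(t)` in `Λ_{L'}` (`≅ Λ_L`, `G_{L'}^{rat}`-stable), and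
  `exists_algEquiv_eq_iota_comp` — PROVED: two embeddings over `ψ` differ by an element of `G_L^{rat}` (model
  form of print's rider «defined up to … inner automorphisms of `π₁^{rat}(†𝒟^⊛)`»);
* `ratHom φ : G_{L'}^{rat} →ₜ* G_L^{rat}` = «the homomorphisms `π₁^{rat}(‡𝒟_v) → π₁^{rat}(†𝒟^⊛)` induced by the
  given poly-morphism»: restriction of scalars to `L(t)`, then Mathlib's `AlgEquiv.restrictNormalHom` onto the
  normal sub-extension `Λ_L` (at the explicit structures `baseAlgebra`/`iotaAlgebra`); defining square
  `iota φ (ratHom φ σ x) = σ (iota φ x)` (`iota_ratHom_apply`, uniqueness `eq_ratHom_of_forall_iota`);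
  CONTINUOUS for the Krull topologies, proved BY HAND (`continuous_ratHomMonoidHom`; risk locus R2: the tower
  `Λ_{L'} / L(t)` is transcendental, so Mathlib's `InfiniteGalois.restrictNormalHom_continuous` does not apply —
  the preimage of `Fix(M)`, `M ⊆ Λ_L` finite-dimensional with basis `b`, contains the open `Fix(L'(t)(ι b))`).

NOT here (other GAP B items): the `∞κ`-coric sets / `CoricPair` packaging (GB-01), the completions `K_v` (GB-02),
base-change stability of `∞κ`-coricity = clause (a) (geometric divisors per #318), the knit `InfKappaLink` at
the stub of record and `Ex54ivInfKappaCompat` (later items).  PROOF/CONSTRUCTION file: no `instance`, no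
notation, no new Prop fact, no `sorry`; constructed-at-the-model ≠ the printed reconstruction ([AbsTopIII]
Thm 1.9 provenance is carrier C2, not this file); nothing here asserts that abc is proved or refuted.
-/

namespace Literature.IUT.HodgeTheaters

namespace RatBaseChange

open Polynomial Literature.FieldTheory.FunctionField
open scoped Polynomial Topology

universe u v

variable {L : Type u} {L' : Type v} [Field L] [Field L'] (φ : L →+* L')

/-! ### The carrier map `ι = iota φ : Λ_L → Λ_{L'}` over `ψ = ratFuncMapCoeffs φ` -/

/-- The `L(t)`-algebra structure on `Λ_{L'} = AlgebraicClosure (L'(t))` obtained through the constant-field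
extension `ψ = ratFuncMapCoeffs φ : L(t) → L'(t)`.  A DEFINITION, deliberately NOT an instance (it depends on
`φ`; consumers bind it with `letI`). ([IUTchI] Ex 5.4 (iv) p.149) [claim: Mochizuki2012, status: disputed] -/
@[reducible]
noncomputable def baseAlgebra : Algebra (RatFunc L) (AlgebraicClosure (RatFunc L')) :=
  ((algebraMap (RatFunc L') (AlgebraicClosure (RatFunc L'))).comp (ratFuncMapCoeffs φ)).toAlgebra

/-- **`ι_v : Λ_{F_mod} → Λ_{K_v}`** at the model: an `L(t)`-embedding of `Λ_L = AlgebraicClosure (L(t))` into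
the algebraically closed `Λ_{L'}` over `ψ` (Mathlib's `IsAlgClosed.lift` — ONE representative; by
`exists_algEquiv_eq_iota_comp` any other differs by an element of `G_L^{rat}`, print's rider «defined up to …
inner automorphisms of `π₁^{rat}(†𝒟^⊛)`»).  On carriers this is the `resKummer` operation of Ex 5.4 (iv)
p. 149 at the model. ([IUTchI] Ex 5.4 (iv) p.149) [claim: Mochizuki2012, status: disputed] -/
noncomputable def iota : AlgebraicClosure (RatFunc L) →+* AlgebraicClosure (RatFunc L') :=
  letI := baseAlgebra φ
  -- the vector-space instance, named explicitly (instance search is slow under this file's imports)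
  haveI : Module.IsTorsionFree (RatFunc L) (AlgebraicClosure (RatFunc L')) :=
    DivisionSemiring.to_moduleIsTorsionFree
  (IsAlgClosed.lift (R := RatFunc L) (S := AlgebraicClosure (RatFunc L))
    (M := AlgebraicClosure (RatFunc L'))).toRingHom

/-- The base-change SQUARE: on rational functions `ι` is `ψ`, i.e. `ι (g) = ψ (g)` for `g ∈ L(t) ⊆ Λ_L`.
([IUTchI] Ex 5.4 (iv) p.149) [claim: Mochizuki2012, status: disputed] -/
theorem iota_algebraMap (g : RatFunc L) :
    iota φ (algebraMap (RatFunc L) (AlgebraicClosure (RatFunc L)) g) =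
      algebraMap (RatFunc L') (AlgebraicClosure (RatFunc L')) (ratFuncMapCoeffs φ g) := by
  letI := baseAlgebra φ
  haveI : Module.IsTorsionFree (RatFunc L) (AlgebraicClosure (RatFunc L')) :=
    DivisionSemiring.to_moduleIsTorsionFree
  exact (IsAlgClosed.lift (R := RatFunc L) (S := AlgebraicClosure (RatFunc L))
    (M := AlgebraicClosure (RatFunc L'))).commutes g

/-- The base-change square as an identity of ring homomorphisms `L(t) → Λ_{L'}`.
([IUTchI] Ex 5.4 (iv) p.149) [claim: Mochizuki2012, status: disputed] -/
theorem iota_comp_algebraMap :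
    (iota φ).comp (algebraMap (RatFunc L) (AlgebraicClosure (RatFunc L))) =
      (algebraMap (RatFunc L') (AlgebraicClosure (RatFunc L'))).comp (ratFuncMapCoeffs φ) :=
  RingHom.ext (iota_algebraMap φ)

/-- `ι` is injective (a homomorphism of fields). ([IUTchI] Ex 5.4 (iv) p.149)
[claim: Mochizuki2012, status: disputed] -/
theorem iota_injective : Function.Injective (iota φ) :=
  (iota φ).injective

/-- Every `ι x` is algebraic over `L'(t)` (a root of the `ψ`-image of an annihilating polynomial of `x`).
([IUTchI] Ex 5.4 (iv) p.149) [claim: Mochizuki2012, status: disputed] -/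
theorem isAlgebraic_iota (x : AlgebraicClosure (RatFunc L)) :
    IsAlgebraic (RatFunc L') (iota φ x) := by
  obtain ⟨p, hp0, hp⟩ := Algebra.IsAlgebraic.isAlgebraic (R := RatFunc L) x
  refine ⟨p.map (ratFuncMapCoeffs φ),
    (Polynomial.map_ne_zero_iff (ratFuncMapCoeffs φ).injective).mpr hp0, ?_⟩
  rw [Polynomial.aeval_def, Polynomial.eval₂_map, ← iota_comp_algebraMap, ← Polynomial.hom_eval₂,
    ← Polynomial.aeval_def, hp, map_zero]

/-! ### The image of an embedding over `ψ` is the relative algebraic closure of `L(t)` in `Λ_{L'}` -/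

/-- **Image = relative algebraic closure**, for ANY ring homomorphism `ι' : Λ_L → Λ_{L'}` over `ψ`:
`y ∈ ι'(Λ_L)` iff `y` is a root of a non-zero polynomial with coefficients in (the image of) `L(t)`.
(`⇐`: such a polynomial splits completely in the algebraically closed `Λ_L`, and `ι'` carries its roots
onto the roots in `Λ_{L'}`.) ([IUTchI] Ex 5.4 (iv) p.149) [claim: Mochizuki2012, status: disputed] -/
theorem mem_range_iff_of_comp_eq (ι' : AlgebraicClosure (RatFunc L) →+* AlgebraicClosure (RatFunc L'))
    (hι' : ι'.comp (algebraMap (RatFunc L) (AlgebraicClosure (RatFunc L))) =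
      (algebraMap (RatFunc L') (AlgebraicClosure (RatFunc L'))).comp (ratFuncMapCoeffs φ))
    (y : AlgebraicClosure (RatFunc L')) :
    y ∈ ι'.range ↔ ∃ p : (RatFunc L)[X], p ≠ 0 ∧
      p.eval₂ ((algebraMap (RatFunc L') (AlgebraicClosure (RatFunc L'))).comp (ratFuncMapCoeffs φ)) y = 0 := by
  constructor
  · rintro ⟨x, rfl⟩
    obtain ⟨p, hp0, hp⟩ := Algebra.IsAlgebraic.isAlgebraic (R := RatFunc L) x
    refine ⟨p, hp0, ?_⟩
    rw [← hι', ← Polynomial.hom_eval₂, ← Polynomial.aeval_def, hp, map_zero]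
  · rintro ⟨p, hp0, hp⟩
    have hq0 : p.map (algebraMap (RatFunc L) (AlgebraicClosure (RatFunc L))) ≠ 0 :=
      (Polynomial.map_ne_zero_iff (algebraMap (RatFunc L) _).injective).mpr hp0
    have hroots := Polynomial.roots_map_of_injective_of_card_eq_natDegree
      (p := p.map (algebraMap (RatFunc L) (AlgebraicClosure (RatFunc L))))
      ι'.injective IsAlgClosed.card_roots_eq_natDegree
    have hy : y ∈ ((p.map (algebraMap (RatFunc L) (AlgebraicClosure (RatFunc L)))).map ι').roots := by
      rw [Polynomial.mem_roots ((Polynomial.map_ne_zero_iff ι'.injective).mpr hq0), Polynomial.IsRoot,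
        Polynomial.eval_map, Polynomial.eval₂_map, hι', hp]
    rw [← hroots, Multiset.mem_map] at hy
    obtain ⟨x, -, rfl⟩ := hy
    exact ⟨x, rfl⟩

/-- **The image of `ι` is the relative algebraic closure of `L(t)` in `Λ_{L'}`** (the identification
«`Λ_{F_mod} ≅` the algebraic closure of `F_mod(t)` inside `Λ_{K_v}`» onto which `ratHom` restricts).
([IUTchI] Ex 5.4 (iv) p.149) [claim: Mochizuki2012, status: disputed] -/
theorem mem_range_iota_iff (y : AlgebraicClosure (RatFunc L')) :
    y ∈ (iota φ).range ↔ ∃ p : (RatFunc L)[X], p ≠ 0 ∧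
      p.eval₂ ((algebraMap (RatFunc L') (AlgebraicClosure (RatFunc L'))).comp (ratFuncMapCoeffs φ)) y = 0 :=
  mem_range_iff_of_comp_eq φ (iota φ) (iota_comp_algebraMap φ) y

/-- The same in Mathlib's vocabulary at the explicit structure `baseAlgebra φ`: `ι(Λ_L)` is the intermediate
field `algebraicClosure L(t) Λ_{L'}`. ([IUTchI] Ex 5.4 (iv) p.149) [claim: Mochizuki2012, status: disputed] -/
theorem mem_range_iota_iff_mem_algebraicClosure (y : AlgebraicClosure (RatFunc L')) :
    y ∈ (iota φ).range ↔
      (letI := baseAlgebra φ; y ∈ algebraicClosure (RatFunc L) (AlgebraicClosure (RatFunc L'))) := by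
  letI := baseAlgebra φ
  rw [mem_algebraicClosure_iff]
  exact mem_range_iota_iff φ y

/-- **All embeddings over `ψ` have the same image** (the relative algebraic closure).
([IUTchI] Ex 5.4 (iv) p.149) [claim: Mochizuki2012, status: disputed] -/
theorem range_eq_range_iota_of_comp_eq
    (ι' : AlgebraicClosure (RatFunc L) →+* AlgebraicClosure (RatFunc L'))
    (hι' : ι'.comp (algebraMap (RatFunc L) (AlgebraicClosure (RatFunc L))) =
      (algebraMap (RatFunc L') (AlgebraicClosure (RatFunc L'))).comp (ratFuncMapCoeffs φ)) :
    ι'.range = (iota φ).range :=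
  Subring.ext fun y => by rw [mem_range_iff_of_comp_eq φ ι' hι', mem_range_iota_iff]

/-- **Uniqueness of `ι` up to `G_L^{rat}`** — the model form of print's rider «the global data … only being
defined up to automorphisms induced by inner automorphisms of `π₁^{rat}(†𝒟^⊛)`»: any ring homomorphism
`ι' : Λ_L → Λ_{L'}` over `ψ` is `ι ∘ τ` for a (unique, by injectivity of `ι`) `τ ∈ G_L^{rat}`.
([IUTchI] Ex 5.4 (iv) p.149) [claim: Mochizuki2012, status: disputed] -/
theorem exists_algEquiv_eq_iota_comp
    (ι' : AlgebraicClosure (RatFunc L) →+* AlgebraicClosure (RatFunc L'))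
    (hι' : ι'.comp (algebraMap (RatFunc L) (AlgebraicClosure (RatFunc L))) =
      (algebraMap (RatFunc L') (AlgebraicClosure (RatFunc L'))).comp (ratFuncMapCoeffs φ)) :
    ∃ τ : AlgebraicClosure (RatFunc L) ≃ₐ[RatFunc L] AlgebraicClosure (RatFunc L),
      ∀ x, ι' x = iota φ (τ x) := by
  have hmem : ∀ x, ι' x ∈ (iota φ).range := fun x =>
    range_eq_range_iota_of_comp_eq φ ι' hι' ▸ ⟨x, rfl⟩
  choose f hf using hmem
  -- `f` is a ring homomorphism fixing `L(t)`, because `ι` is injective and `ι ∘ f = ι'`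
  have hinj := iota_injective φ
  let τ₀ : AlgebraicClosure (RatFunc L) →ₐ[RatFunc L] AlgebraicClosure (RatFunc L) :=
    { toFun := f
      map_one' := hinj (by rw [hf, map_one, map_one])
      map_mul' := fun x y => hinj (by rw [hf, map_mul, map_mul, hf, hf])
      map_zero' := hinj (by rw [hf, map_zero, map_zero])
      map_add' := fun x y => hinj (by rw [hf, map_add, map_add, hf, hf])
      commutes' := fun g => hinj (by
        rw [hf, iota_algebraMap, ← RingHom.comp_apply, hι', RingHom.comp_apply]) }
  refine ⟨AlgEquiv.ofBijective τ₀ (Algebra.IsAlgebraic.algHom_bijective τ₀), fun x => ?_⟩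
  exact (hf x).symm

/-- Conversely `ι ∘ τ` is an embedding over `ψ` for every `τ ∈ G_L^{rat}`. ([IUTchI] Ex 5.4 (iv) p.149)
[claim: Mochizuki2012, status: disputed] -/
theorem iota_comp_algEquiv_comp_algebraMap
    (τ : AlgebraicClosure (RatFunc L) ≃ₐ[RatFunc L] AlgebraicClosure (RatFunc L)) :
    ((iota φ).comp (τ : AlgebraicClosure (RatFunc L) →+* AlgebraicClosure (RatFunc L))).comp
        (algebraMap (RatFunc L) (AlgebraicClosure (RatFunc L))) =
      (algebraMap (RatFunc L') (AlgebraicClosure (RatFunc L'))).comp (ratFuncMapCoeffs φ) :=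
  RingHom.ext fun g => by simp [iota_algebraMap]

/-- The image of `ι` is stable under every `σ ∈ G_{L'}^{rat}` (the relative algebraic closure is
characteristic). ([IUTchI] Ex 5.4 (iv) p.149) [claim: Mochizuki2012, status: disputed] -/
theorem apply_mem_range_iota
    (σ : AlgebraicClosure (RatFunc L') ≃ₐ[RatFunc L'] AlgebraicClosure (RatFunc L'))
    {y : AlgebraicClosure (RatFunc L')} (hy : y ∈ (iota φ).range) : σ y ∈ (iota φ).range := by
  rw [mem_range_iota_iff] at hy ⊢
  obtain ⟨p, hp0, hp⟩ := hy
  refine ⟨p, hp0, ?_⟩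
  -- `σ` fixes `L'(t)` pointwise, hence the coefficient embedding `L(t) → Λ_{L'}`
  have hσ : (σ : AlgebraicClosure (RatFunc L') →+* AlgebraicClosure (RatFunc L')).comp
      ((algebraMap (RatFunc L') (AlgebraicClosure (RatFunc L'))).comp (ratFuncMapCoeffs φ)) =
      (algebraMap (RatFunc L') (AlgebraicClosure (RatFunc L'))).comp (ratFuncMapCoeffs φ) :=
    RingHom.ext fun g => σ.commutes (ratFuncMapCoeffs φ g)
  have h := Polynomial.hom_eval₂ p ((algebraMap (RatFunc L') (AlgebraicClosure (RatFunc L'))).comp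
    (ratFuncMapCoeffs φ)) (σ : AlgebraicClosure (RatFunc L') →+* AlgebraicClosure (RatFunc L')) y
  rw [hσ, hp, map_zero] at h
  exact h.symm

/-! ### The induced homomorphism `ratHom φ : G_{L'}^{rat} → G_L^{rat}` and its continuity -/

/-- The `Λ_L`-algebra structure on `Λ_{L'}` through `ι` (a `def`, NOT an instance).
([IUTchI] Ex 5.4 (iv) p.149) [claim: Mochizuki2012, status: disputed] -/
@[reducible]
noncomputable def iotaAlgebra : Algebra (AlgebraicClosure (RatFunc L)) (AlgebraicClosure (RatFunc L')) :=
  (iota φ).toAlgebra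

/-- The tower `L(t) → Λ_L →ι Λ_{L'}` agrees with `L(t) →ψ L'(t) → Λ_{L'}` (the base-change square as a
scalar-tower statement at the explicit structures). ([IUTchI] Ex 5.4 (iv) p.149)
[claim: Mochizuki2012, status: disputed] -/
theorem isScalarTower_iota :
    letI := baseAlgebra φ
    letI := iotaAlgebra φ
    IsScalarTower (RatFunc L) (AlgebraicClosure (RatFunc L)) (AlgebraicClosure (RatFunc L')) :=
  letI := baseAlgebra φ
  letI := iotaAlgebra φ
  IsScalarTower.of_algebraMap_eq fun g => (iota_algebraMap φ g).symm

/-- Restriction of scalars along `ψ`: an `L'(t)`-automorphism of `Λ_{L'}` is in particular an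
`L(t)`-automorphism (same underlying ring isomorphism). ([IUTchI] Ex 5.4 (iv) p.149)
[claim: Mochizuki2012, status: disputed] -/
noncomputable def restrictBase
    (σ : AlgebraicClosure (RatFunc L') ≃ₐ[RatFunc L'] AlgebraicClosure (RatFunc L')) :
    letI := baseAlgebra φ
    AlgebraicClosure (RatFunc L') ≃ₐ[RatFunc L] AlgebraicClosure (RatFunc L') :=
  letI := baseAlgebra φ
  AlgEquiv.ofRingEquiv (f := σ.toRingEquiv) fun g => σ.commutes (ratFuncMapCoeffs φ g)

/-- Restriction of scalars along `ψ` as a group homomorphism `G_{L'}^{rat} → Aut_{L(t)}(Λ_{L'})`.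
([IUTchI] Ex 5.4 (iv) p.149) [claim: Mochizuki2012, status: disputed] -/
noncomputable def restrictBaseHom :
    letI := baseAlgebra φ
    (AlgebraicClosure (RatFunc L') ≃ₐ[RatFunc L'] AlgebraicClosure (RatFunc L')) →*
      (AlgebraicClosure (RatFunc L') ≃ₐ[RatFunc L] AlgebraicClosure (RatFunc L')) :=
  letI := baseAlgebra φ
  MonoidHom.mk' (restrictBase φ) fun _ _ => AlgEquiv.ext fun _ => rfl

/-- **`ratHom_v : π₁^{rat}(‡𝒟_v) → π₁^{rat}(†𝒟^⊛)` at the model, as a group homomorphism**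
`G_{L'}^{rat} → G_L^{rat}`: restrict scalars to `L(t)`, then restrict to the normal sub-extension
`Λ_L ↪ι Λ_{L'}` (Mathlib's `AlgEquiv.restrictNormalHom`, at the explicit structures
`baseAlgebra`/`iotaAlgebra`).  Print: «the various homomorphisms `π₁^{rat}(‡𝒟_v) → π₁^{rat}(†𝒟^⊛)` … induced
[cf. … [AbsTopIII], Theorem 1.9, and [AbsTopIII], Corollaries 1.10, 2.8] by the given poly-morphism» — here
at the MODEL presentation (the reconstruction provenance is carrier C2, not this file).
([IUTchI] Ex 5.4 (iv) p.149) [claim: Mochizuki2012, status: disputed] -/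
noncomputable def ratHomMonoidHom :
    (AlgebraicClosure (RatFunc L') ≃ₐ[RatFunc L'] AlgebraicClosure (RatFunc L')) →*
      (AlgebraicClosure (RatFunc L) ≃ₐ[RatFunc L] AlgebraicClosure (RatFunc L)) :=
  letI := baseAlgebra φ
  letI := iotaAlgebra φ
  haveI := isScalarTower_iota φ
  (AlgEquiv.restrictNormalHom (F := RatFunc L) (K₁ := AlgebraicClosure (RatFunc L'))
      (AlgebraicClosure (RatFunc L))).comp (restrictBaseHom φ)

/-- **The defining square of `ratHom`**: `ι (ratHom σ x) = σ (ι x)` — `ι` intertwines the action of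
`ratHom σ ∈ G_L^{rat}` on `Λ_L` with that of `σ ∈ G_{L'}^{rat}` on `Λ_{L'}` (the equivariance clause (b) of
Ex 5.4 (iv) asks of the arrow of the display, here on ALL of `Λ_L`).
([IUTchI] Ex 5.4 (iv) p.149) [claim: Mochizuki2012, status: disputed] -/
theorem iota_ratHomMonoidHom_apply
    (σ : AlgebraicClosure (RatFunc L') ≃ₐ[RatFunc L'] AlgebraicClosure (RatFunc L'))
    (x : AlgebraicClosure (RatFunc L)) :
    iota φ (ratHomMonoidHom φ σ x) = σ (iota φ x) := by
  letI := baseAlgebra φ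
  letI := iotaAlgebra φ
  haveI := isScalarTower_iota φ
  exact AlgEquiv.restrictNormal_commutes (restrictBase φ σ) (AlgebraicClosure (RatFunc L)) x

/-- Uniqueness: `ratHom σ` is the ONLY `L(t)`-automorphism of `Λ_L` fitting into the square with `σ`
(`ι` is injective). ([IUTchI] Ex 5.4 (iv) p.149) [claim: Mochizuki2012, status: disputed] -/
theorem eq_ratHomMonoidHom_of_forall_iota
    (σ : AlgebraicClosure (RatFunc L') ≃ₐ[RatFunc L'] AlgebraicClosure (RatFunc L'))
    (τ : AlgebraicClosure (RatFunc L) ≃ₐ[RatFunc L] AlgebraicClosure (RatFunc L))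
    (h : ∀ x, iota φ (τ x) = σ (iota φ x)) : τ = ratHomMonoidHom φ σ :=
  AlgEquiv.ext fun x => iota_injective φ (by rw [h, iota_ratHomMonoidHom_apply])

/-- **Continuity of `ratHom` for the Krull topologies, BY HAND** (risk locus R2: `Λ_{L'} / L(t)` is a
transcendental tower).  Given a finite-dimensional `M ⊆ Λ_L` over `L(t)` with basis `b₁, …, b_n`, the
intermediate field `M' := L'(t)(ι b₁, …, ι b_n) ⊆ Λ_{L'}` is finite-dimensional (each `ι bᵢ` is algebraic),
and every `σ` fixing `M'` pointwise has `ratHom σ` fixing `M` pointwise (defining square + injectivity of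
`ι`); so the preimage of the basic open subgroup `Fix(M)` contains the open subgroup `Fix(M')`.
([IUTchI] Ex 5.4 (iv) p.149) [claim: Mochizuki2012, status: disputed] -/
theorem continuous_ratHomMonoidHom : Continuous (ratHomMonoidHom φ) := by
  apply continuous_of_continuousAt_one _ (continuousAt_def.mpr _)
  intro N hN
  rw [map_one, krullTopology_mem_nhds_one_iff] at hN
  obtain ⟨M, hMfin, hMN⟩ := hN
  let b := Module.finBasis (RatFunc L) M
  let T : Set (AlgebraicClosure (RatFunc L')) :=
    Set.range fun i => iota φ (b i : AlgebraicClosure (RatFunc L))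
  have hT : ∀ y ∈ T, IsIntegral (RatFunc L') y := by
    rintro _ ⟨i, rfl⟩
    exact (isAlgebraic_iota φ _).isIntegral
  haveI : Finite T := (Set.finite_range _).to_subtype
  haveI := IntermediateField.finiteDimensional_adjoin (K := RatFunc L') hT
  rw [mem_nhds_iff]
  refine ⟨(IntermediateField.adjoin (RatFunc L') T).fixingSubgroup, ?_,
    IntermediateField.fixingSubgroup_isOpen _, Subgroup.one_mem _⟩
  intro σ hσ
  apply hMN
  simp only [SetLike.mem_coe, IntermediateField.mem_fixingSubgroup_iff] at hσ ⊢
  have hb : ∀ i, ratHomMonoidHom φ σ (b i) = b i := fun i => by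
    apply iota_injective φ
    rw [iota_ratHomMonoidHom_apply]
    exact hσ _ (IntermediateField.subset_adjoin _ _ ⟨i, rfl⟩)
  have key : (ratHomMonoidHom φ σ).toLinearMap ∘ₗ M.val.toLinearMap = M.val.toLinearMap :=
    b.ext fun i => by simpa using hb i
  intro m hm
  simpa using LinearMap.congr_fun key ⟨m, hm⟩

/-- **`ratHom_v : π₁^{rat}(‡𝒟_v) →ₜ* π₁^{rat}(†𝒟^⊛)` at the model** — the CONTINUOUS group homomorphism
`G_{L'}^{rat} → G_L^{rat}` (the shape of the `InfKappaLink.ratHom` field, a `ContinuousMonoidHom`).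
([IUTchI] Ex 5.4 (iv) p.149) [claim: Mochizuki2012, status: disputed] -/
noncomputable def ratHom :
    ContinuousMonoidHom (AlgebraicClosure (RatFunc L') ≃ₐ[RatFunc L'] AlgebraicClosure (RatFunc L'))
      (AlgebraicClosure (RatFunc L) ≃ₐ[RatFunc L] AlgebraicClosure (RatFunc L)) where
  toMonoidHom := ratHomMonoidHom φ
  continuous_toFun := continuous_ratHomMonoidHom φ

/-- `ratHom` and `ratHomMonoidHom` agree. ([IUTchI] Ex 5.4 (iv) p.149) [claim: Mochizuki2012, status: disputed] -/
@[simp] theorem ratHom_apply (σ : AlgebraicClosure (RatFunc L') ≃ₐ[RatFunc L'] AlgebraicClosure (RatFunc L')) :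
    ratHom φ σ = ratHomMonoidHom φ σ :=
  rfl

/-- `ratHom` is continuous. ([IUTchI] Ex 5.4 (iv) p.149) [claim: Mochizuki2012, status: disputed] -/
theorem continuous_ratHom : Continuous (ratHom φ) :=
  continuous_ratHomMonoidHom φ

/-- The defining square for the bundled `ratHom`: `ι (ratHom σ x) = σ (ι x)`.
([IUTchI] Ex 5.4 (iv) p.149) [claim: Mochizuki2012, status: disputed] -/
theorem iota_ratHom_apply (σ : AlgebraicClosure (RatFunc L') ≃ₐ[RatFunc L'] AlgebraicClosure (RatFunc L'))
    (x : AlgebraicClosure (RatFunc L)) : iota φ (ratHom φ σ x) = σ (iota φ x) :=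
  iota_ratHomMonoidHom_apply φ σ x

/-- **Equivariance in the `MulAction` form of clause (b) of `Ex54ivInfKappaCompat`**
(`resKummer (ratHom γ • m) = γ • resKummer m`), for the tautological actions of the Galois groups
(`AlgEquiv.applyMulSemiringAction`), on all of `Λ_L`. ([IUTchI] Ex 5.4 (iv) p.149)
[claim: Mochizuki2012, status: disputed] -/
theorem iota_ratHom_smul (σ : AlgebraicClosure (RatFunc L') ≃ₐ[RatFunc L'] AlgebraicClosure (RatFunc L'))
    (x : AlgebraicClosure (RatFunc L)) : iota φ (ratHom φ σ • x) = σ • iota φ x :=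
  iota_ratHomMonoidHom_apply φ σ x

/-- Uniqueness for the bundled `ratHom`. ([IUTchI] Ex 5.4 (iv) p.149)
[claim: Mochizuki2012, status: disputed] -/
theorem eq_ratHom_of_forall_iota
    (σ : AlgebraicClosure (RatFunc L') ≃ₐ[RatFunc L'] AlgebraicClosure (RatFunc L'))
    (τ : AlgebraicClosure (RatFunc L) ≃ₐ[RatFunc L] AlgebraicClosure (RatFunc L))
    (h : ∀ x, iota φ (τ x) = σ (iota φ x)) : τ = ratHom φ σ :=
  eq_ratHomMonoidHom_of_forall_iota φ σ τ h

/-- `ratHom σ` fixes an element of `Λ_L` iff `σ` fixes its `ι`-image (for openness / kernel computations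
downstream). ([IUTchI] Ex 5.4 (iv) p.149) [claim: Mochizuki2012, status: disputed] -/
theorem ratHom_apply_eq_self_iff
    (σ : AlgebraicClosure (RatFunc L') ≃ₐ[RatFunc L'] AlgebraicClosure (RatFunc L'))
    (x : AlgebraicClosure (RatFunc L)) : ratHom φ σ x = x ↔ σ (iota φ x) = iota φ x := by
  rw [← iota_ratHom_apply, (iota_injective φ).eq_iff]

/-- **The inner-automorphism indeterminacy, made explicit**: replacing the representative `ι` by `ι ∘ τ`
(`τ ∈ G_L^{rat}`, cf. `exists_algEquiv_eq_iota_comp`) replaces `ratHom σ` by its conjugate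
`τ⁻¹ · ratHom σ · τ` — the square for `ι ∘ τ`. ([IUTchI] Ex 5.4 (iv) p.149)
[claim: Mochizuki2012, status: disputed] -/
theorem iota_comp_conj_ratHom_apply
    (τ : AlgebraicClosure (RatFunc L) ≃ₐ[RatFunc L] AlgebraicClosure (RatFunc L))
    (σ : AlgebraicClosure (RatFunc L') ≃ₐ[RatFunc L'] AlgebraicClosure (RatFunc L'))
    (x : AlgebraicClosure (RatFunc L)) :
    iota φ (τ ((τ⁻¹ * ratHom φ σ * τ) x)) = σ (iota φ (τ x)) := by
  rw [AlgEquiv.mul_apply, AlgEquiv.mul_apply, ← AlgEquiv.mul_apply τ τ⁻¹, mul_inv_cancel, AlgEquiv.one_apply,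
    iota_ratHom_apply]

end RatBaseChange

end Literature.IUT.HodgeTheaters
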